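import Mathlib.Data.Finset.Card
import Mathlib.Data.Nat.GCD.Basic
import Mathlib.Tactic.NormNum
import Mathlib.Tactic.Linarith
import HarnessLib

set_option linter.dupNamespace false

/-!
# Weil-type family coverage — TYPE-III WINDOWS, part I (census block b04.23): the COMPLEMENT LAW for half-system counts, and the
CM-type certificates of the levels `17, 19, 25, 34, 38, 50`

research route conditional on HC_CM; not a corollary; Q11.4-sentence-2 already refuted in dim ≥ 3.

Ring 2, WEIL-TYPE FAMILY-COVERAGE CENSUS (`HOME/WEIL-FAMILY-COVERAGE.md` `## b04`, block b04.23, owner ring2-b04, gen 59; theory notes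
`HOME/pub-hodge-ring2-b04/census-g58/theory/THEOREMS-S24.md` §1 (2) and `census-g59/theory/THEOREMS-S25.md`).  SETTING (informal, NOT
formalised): for a level `m` and a CM type `Φ ⊂ (ℤ/m)^×` (`Φ ⊔ −Φ = (ℤ/m)^×`) of a Fermat quotient `y^m = x^a(x−1)^b`, THEOREM S24.1 (2) reads
the norm-residue symbol of the CM element against `ζ − ζ^{−1}` at the ramified place as `(−1)^{N_m}`, `N_m = #(Φ ∩ (0, m/2))` (the HALF-SYSTEM
COUNT).  The complex-conjugate type `−Φ = {m − k}` belongs to the inverse class / the conjugate CM element `β̄ = −β`, and the two symbols must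
differ by `(−1, E_𝔩/F_𝔩) = (−1)^{(p−1)/2} = (−1)^{φ(m)/2}` (`m = p^j`).  THIS FILE proves in the kernel the combinatorial identity behind
that consistency, in full generality and with no arithmetic input:
  COMPLEMENT LAW.  For any finite `U ⊂ ℕ` of residues `0 < k < m` with `2k ≠ m`, stable under `k ↦ m − k`, and any `Φ ⊆ U` with
  `k ∈ Φ ↔ m − k ∉ Φ` on `U` (a «CM type» of `U`):  `N(Φ) + N(U ∖ Φ) = #Φ`, where `N(X) = #{k ∈ X : 2k < m}`.
  (So `N(−Φ) = #Φ − N(Φ) = φ(m)/2 − N(Φ)` for a genuine CM type: the parities of `N(Φ)` and `N(−Φ)` agree iff `φ(m)/2` is even.)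
and then records, as closed decidable computations in the style of part H (`Ring2WeilCoverageLocalFormula`), the CM types / half-system counts
of the data that the carriers NEW in gen 59's tables bring in: levels `17` (`SL₂(17)`), `19` (`SL₂(19)`), `25` (`SL₂(49)`, elements of order
`25`), for the datum `(1,1,m−2)` and for the `2`-power-twisted data `(a, a, −2a)`, `a = 2^{t−1}, 2^{t−2}`, `t = ord(2 mod m)`, that COROLLARY
S24.3 uses (`u_ℓ(g) = −(w_{t−1} + 2w_{t−2})`), and levels `34, 38, 50` (data `(n, n+1, 2n−1)` of the classes `z·g`): there the half-system
count is `0` (the type is the upper half-system), as for levels `6` and `10` in part H.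
What is NOT here: anything about quadratic forms, Fermat curves or Hodge classes; `HC_CM` is used nowhere.  No `sorry`, no definitions.
-/

namespace Summit.HodgeConjecture.HodgeConjecture.Ring2.WeilCoverage

open Finset

/-- COMPLEMENT LAW for half-system counts (THEOREMS-S25 §1; consistency of THEOREM S24.1 (2) under `β ↦ β̄ = −β`).  Let `U` be a finite set of
naturals with `0 < k < m` and `2k ≠ m` for `k ∈ U`, stable under `k ↦ m − k`; let `Φ ⊆ U` satisfy the CM-type condition `k ∈ Φ ↔ m − k ∉ Φ`
for all `k ∈ U`.  Then `#{k ∈ Φ : 2k < m} + #{k ∈ U ∖ Φ : 2k < m} = #Φ`: the reflection `k ↦ m − k` is a bijection from the lower half of the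
complement onto the upper half of `Φ`.
research route conditional on HC_CM; not a corollary; Q11.4-sentence-2 already refuted in dim ≥ 3. -/
theorem halfSystem_complement (m : ℕ) (U Φ : Finset ℕ)
    (hU : ∀ k ∈ U, 0 < k ∧ k < m ∧ 2 * k ≠ m) (hsym : ∀ k ∈ U, m - k ∈ U) (hΦU : Φ ⊆ U)
    (hcm : ∀ k ∈ U, (k ∈ Φ ↔ m - k ∉ Φ)) :
    (Φ.filter (fun k => 2 * k < m)).card + ((U \ Φ).filter (fun k => 2 * k < m)).card = Φ.card := by
  classical
  -- split Φ into its lower and upper halves (no element sits at 2k = m)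
  have hsplit : Φ = (Φ.filter (fun k => 2 * k < m)) ∪ (Φ.filter (fun k => m < 2 * k)) := by
    ext k
    simp only [Finset.mem_union, Finset.mem_filter]
    constructor
    · intro hk
      have h3 := (hU k (hΦU hk)).2.2
      rcases Nat.lt_or_gt_of_ne h3 with h | h
      · exact Or.inl ⟨hk, h⟩
      · exact Or.inr ⟨hk, h⟩
    · rintro (⟨hk, _⟩ | ⟨hk, _⟩) <;> exact hk
  have hdisj : Disjoint (Φ.filter (fun k => 2 * k < m)) (Φ.filter (fun k => m < 2 * k)) := by
    rw [Finset.disjoint_filter]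
    intro k _ h1 h2
    omega
  have hcardΦ : Φ.card = (Φ.filter (fun k => 2 * k < m)).card + (Φ.filter (fun k => m < 2 * k)).card := by
    conv_lhs => rw [hsplit]
    exact Finset.card_union_of_disjoint hdisj
  -- the reflection k ↦ m - k : lower half of U \ Φ ≃ upper half of Φ
  have hbij : ((U \ Φ).filter (fun k => 2 * k < m)).card = (Φ.filter (fun k => m < 2 * k)).card := by
    apply Finset.card_bij' (fun k _ => m - k) (fun k _ => m - k)
    · intro k hk
      simp only [Finset.mem_filter, Finset.mem_sdiff] at hk ⊢
      obtain ⟨⟨hkU, hkΦ⟩, hk2⟩ := hk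
      have hb := hU k hkU
      refine ⟨?_, ?_⟩
      · by_contra hnot
        exact hkΦ (((hcm k hkU).mpr hnot))
      · omega
    · intro k hk
      simp only [Finset.mem_filter, Finset.mem_sdiff] at hk ⊢
      obtain ⟨hkΦ, hk2⟩ := hk
      have hkU := hΦU hkΦ
      have hb := hU k hkU
      refine ⟨⟨hsym k hkU, ?_⟩, ?_⟩
      · exact (hcm k hkU).mp hkΦ
      · omega
    · intro k hk
      simp only [Finset.mem_filter, Finset.mem_sdiff] at hk
      have hb := hU k hk.1.1
      omega
    · intro k hk
      simp only [Finset.mem_filter] at hk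
      have hb := hU k (hΦU hk.1)
      omega
  omega

/-- Parity form of the complement law: under the same hypotheses the two half-system counts have the same parity iff `#Φ` is even
(`N(−Φ) ≡ #Φ − N(Φ)`); for a CM type of `(ℤ/p^j)^×` (`#Φ = φ(p^j)/2 ≡ (p−1)/2 (mod 2)`) this is the sign `(−1)^{(p−1)/2} = (−1, E_𝔩/F_𝔩)` by
which the norm-residue symbols of `β` and `β̄ = −β` differ (THEOREMS-S25 §1, remark).
research route conditional on HC_CM; not a corollary; Q11.4-sentence-2 already refuted in dim ≥ 3. -/
theorem halfSystem_complement_parity (m : ℕ) (U Φ : Finset ℕ)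
    (hU : ∀ k ∈ U, 0 < k ∧ k < m ∧ 2 * k ≠ m) (hsym : ∀ k ∈ U, m - k ∈ U) (hΦU : Φ ⊆ U)
    (hcm : ∀ k ∈ U, (k ∈ Φ ↔ m - k ∉ Φ)) :
    ((Φ.filter (fun k => 2 * k < m)).card % 2 = ((U \ Φ).filter (fun k => 2 * k < m)).card % 2) ↔ Φ.card % 2 = 0 := by
  have h := halfSystem_complement m U Φ hU hsym hΦU hcm
  omega

/-! ## CM-type certificates for the levels of the gen-59 carriers (encoding as in part H: `k ∈ Φ^*(a,b,c)` iff
`((m − ka mod m) mod m) + ((m − kb mod m) mod m) + ((m − kc mod m) mod m) = 2m`; half-system count = cardinality of the part below `m/2`). -/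

/-- Level 17 (classes of order 17 of `SL₂(17)`; `t = ord(2 mod 17) = 8`, twisted exponents `2⁷ ≡ 9`, `2⁶ ≡ 13`): datum `(1,1,15)`:
`Φ^* = {1,…,8}`, `N = 8`; datum `(9,9,16)`: `N = 4`; datum `(13,13,8)`: `N = 4` — all EVEN (the CM units are residues at the prime over 17).
research route conditional on HC_CM; not a corollary; Q11.4-sentence-2 already refuted in dim ≥ 3. -/
theorem cmType_seventeen :
    (Finset.filter (fun k => 0 < k ∧ Nat.Coprime k 17 ∧
      (17 - k * 1 % 17) % 17 + (17 - k * 1 % 17) % 17 + (17 - k * 15 % 17) % 17 = 34) (Finset.range 17)) = {1, 2, 3, 4, 5, 6, 7, 8} ∧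
    (Finset.filter (fun k => 2 * k < 17) (Finset.filter (fun k => 0 < k ∧ Nat.Coprime k 17 ∧
      (17 - k * 9 % 17) % 17 + (17 - k * 9 % 17) % 17 + (17 - k * 16 % 17) % 17 = 34) (Finset.range 17))).card = 4 ∧
    (Finset.filter (fun k => 2 * k < 17) (Finset.filter (fun k => 0 < k ∧ Nat.Coprime k 17 ∧
      (17 - k * 13 % 17) % 17 + (17 - k * 13 % 17) % 17 + (17 - k * 8 % 17) % 17 = 34) (Finset.range 17))).card = 4 := by decide

/-- Level 19 (classes of order 19 of `SL₂(19)`; `t = ord(2 mod 19) = 18`, twisted exponents `2¹⁷ ≡ 10`, `2¹⁶ ≡ 5`): datum `(1,1,17)`: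
`N = 9`; datum `(10,10,18)`: `Φ^* = {2,4,…,18}` (the even residues), `N = 4`; datum `(5,5,9)`: `Φ^* = {1,4,5,8,9,12,13,16,17}`, `N = 5` — the
two twisted data have OPPOSITE parities.
research route conditional on HC_CM; not a corollary; Q11.4-sentence-2 already refuted in dim ≥ 3. -/
theorem cmType_nineteen :
    (Finset.filter (fun k => 2 * k < 19) (Finset.filter (fun k => 0 < k ∧ Nat.Coprime k 19 ∧
      (19 - k * 1 % 19) % 19 + (19 - k * 1 % 19) % 19 + (19 - k * 17 % 19) % 19 = 38) (Finset.range 19))).card = 9 ∧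
    (Finset.filter (fun k => 0 < k ∧ Nat.Coprime k 19 ∧
      (19 - k * 10 % 19) % 19 + (19 - k * 10 % 19) % 19 + (19 - k * 18 % 19) % 19 = 38) (Finset.range 19)) =
      {2, 4, 6, 8, 10, 12, 14, 16, 18} ∧
    (Finset.filter (fun k => 2 * k < 19) (Finset.filter (fun k => 0 < k ∧ Nat.Coprime k 19 ∧
      (19 - k * 10 % 19) % 19 + (19 - k * 10 % 19) % 19 + (19 - k * 18 % 19) % 19 = 38) (Finset.range 19))).card = 4 ∧
    (Finset.filter (fun k => 0 < k ∧ Nat.Coprime k 19 ∧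
      (19 - k * 5 % 19) % 19 + (19 - k * 5 % 19) % 19 + (19 - k * 9 % 19) % 19 = 38) (Finset.range 19)) =
      {1, 4, 5, 8, 9, 12, 13, 16, 17} ∧
    (Finset.filter (fun k => 2 * k < 19) (Finset.filter (fun k => 0 < k ∧ Nat.Coprime k 19 ∧
      (19 - k * 5 % 19) % 19 + (19 - k * 5 % 19) % 19 + (19 - k * 9 % 19) % 19 = 38) (Finset.range 19))).card = 5 := by decide

/-- Level 25 (classes of order 25 of `SL₂(49)`; `t = ord(2 mod 25) = 20`, twisted exponents `2¹⁹ ≡ 13`, `2¹⁸ ≡ 19`): datum `(1,1,23)`: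
`Φ^* = {1,2,3,4,6,7,8,9,11,12}` (size `φ(25)/2 = 10`), `N = 10`; datum `(13,13,24)`: `N = 5`; datum `(19,19,12)`: `N = 6` — OPPOSITE parities.
research route conditional on HC_CM; not a corollary; Q11.4-sentence-2 already refuted in dim ≥ 3. -/
theorem cmType_twentyfive :
    (Finset.filter (fun k => 0 < k ∧ Nat.Coprime k 25 ∧
      (25 - k * 1 % 25) % 25 + (25 - k * 1 % 25) % 25 + (25 - k * 23 % 25) % 25 = 50) (Finset.range 25)) =
      {1, 2, 3, 4, 6, 7, 8, 9, 11, 12} ∧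
    (Finset.filter (fun k => 2 * k < 25) (Finset.filter (fun k => 0 < k ∧ Nat.Coprime k 25 ∧
      (25 - k * 13 % 25) % 25 + (25 - k * 13 % 25) % 25 + (25 - k * 24 % 25) % 25 = 50) (Finset.range 25))).card = 5 ∧
    (Finset.filter (fun k => 2 * k < 25) (Finset.filter (fun k => 0 < k ∧ Nat.Coprime k 25 ∧
      (25 - k * 19 % 25) % 25 + (25 - k * 19 % 25) % 25 + (25 - k * 12 % 25) % 25 = 50) (Finset.range 25))).card = 6 := by decide

/-- Levels `34, 38, 50` (classes `z·g`, `g` of order `17, 19, 25`; datum `(n, n+1, 2n−1)` of COROLLARY S24.3): the CM type is the UPPER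
half-system of odd residues (`{19,21,…,33}`, `{21,…,37}`, `{27,…,49} ∖ {35,45}`), so the half-system count is `0` in all three cases — as for
levels `6` and `10` in part H.
research route conditional on HC_CM; not a corollary; Q11.4-sentence-2 already refuted in dim ≥ 3. -/
theorem cmType_doubled_levels :
    (Finset.filter (fun k => 0 < k ∧ Nat.Coprime k 34 ∧
      (34 - k * 17 % 34) % 34 + (34 - k * 18 % 34) % 34 + (34 - k * 33 % 34) % 34 = 68) (Finset.range 34)) =
      {19, 21, 23, 25, 27, 29, 31, 33} ∧
    (Finset.filter (fun k => 2 * k < 38) (Finset.filter (fun k => 0 < k ∧ Nat.Coprime k 38 ∧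
      (38 - k * 19 % 38) % 38 + (38 - k * 20 % 38) % 38 + (38 - k * 37 % 38) % 38 = 76) (Finset.range 38))).card = 0 ∧
    (Finset.filter (fun k => 0 < k ∧ Nat.Coprime k 50 ∧
      (50 - k * 25 % 50) % 50 + (50 - k * 26 % 50) % 50 + (50 - k * 49 % 50) % 50 = 100) (Finset.range 50)) =
      {27, 29, 31, 33, 37, 39, 41, 43, 47, 49} := by decide

end Summit.HodgeConjecture.HodgeConjecture.Ring2.WeilCoverage
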